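import Literature.AlgebraicGeometry.VanGeemenVerra2003.QuaternionicHodgeClasses
import Literature.AlgebraicGeometry.HodgeTheory.WeilTypeOfQuaternionAction
import Literature.AlgebraicGeometry.HodgeTheory.WeilClassesRationalPlane
import Literature.AlgebraicGeometry.HodgeTheory.HodgeClassesIsogenyInvariance
import Mathlib.LinearAlgebra.Vandermonde
import Mathlib.LinearAlgebra.Matrix.NonsingularInverse
import Mathlib.Data.Prod.Lex
import HarnessLib

/-!
# Van Geemen–Verra 2003, Proposition 4.7: the quaternion classes `W_F ⊗ ℂ` — independence of the
# quadratic subfield, `W_F ⊗ ℂ ⊆ Bⁿ ⊗ ℂ`, and `dim W_F = 2n + 1` — PROVED on the carriers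

Pure Literature (theorems only: no definition, no named fact, no Summit import; D-0026).

B. van Geemen, A. Verra, *Quaternionic Pryms and Hodge classes*, Topology **42** (2003) 35–53
[vanGeemenVerra2003QuaternionicPryms] (held: `paper:arxiv-math_0103111`, §4 pp. 9–10), 4.6–4.7:

> "4.6 … We define the subspace `W_F ⊂ H^{2n}(A, ℚ)` as the subspace spanned by the translates
> `x · W_K` where `x` runs over `F` and `W_K` is the space of Weil classes for the field `K`."
> "4.7 Proposition. The subspace `W_F` does not depend on the choice of the quadratic subfield
> `K ⊂ F` and: `W_F ⊂ H^{2n}(A, ℚ) ∩ H^{n,n}(A)`, `dim_ℚ W_F = 2n + 1`."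
> (Proof, p. 9: "`H¹(A, ℂ) ≅ W ⊗ U` … `W_F ⊗ ℂ ≅ ⋀^{2n}W ⊗ S^{2n}U` … of dimension `2n + 1`.")

The tree's named fact `VanGeemenVerra2003_quaternionHodgeClasses`
(`VanGeemenVerra2003/QuaternionicHodgeClasses`) vendors Lemma 4.5 + Prop. 4.7 + §4.8 ([A] Thm. 4.1) as
ONE `Prop`, under the polarization hypotheses of a polarized abelian variety of quaternion type. This
file PROVES the three Prop. 4.7 conjuncts of that fact — for the two generating subfields `K = ℚ(φ)`,
`K = ℚ(χ)` of the fact's typing — as theorems, and WITHOUT the polarization hypotheses: for a complex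
abelian variety `A` of dimension `2n` with endomorphisms `φ, χ`, `φ ≫ φ = -a`, `χ ≫ χ = -b`
(`a, b ≥ 1`), `φ ≫ χ = -(χ ≫ φ)` (so `F = ℚ⟨φ, χ⟩ = (-a,-b)_ℚ` acts on `A` up to isogeny),

* `quaternionClasses_eq_quaternionClasses` — **`W_F ⊗ ℂ` built from `K = ℚ(φ)` equals the one built
  from `K = ℚ(χ)`**: `quaternionClasses A φ χ φ n a = quaternionClasses A φ χ χ n b`;
* `quaternionClasses_le_hodgeClassSpan` — **`W_F ⊗ ℂ ⊆ Bⁿ ⊗ ℂ`** (`n ≥ 1`):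
  `quaternionClasses A φ χ φ n a ≤ VanGeemen1994.hodgeClassSpan A.dim A.X n`;
* `finrank_quaternionClasses` — **`dim_ℂ (W_F ⊗ ℂ) = 2n + 1`**;
* `prop47` — the conjunction, in the literal shape of conjuncts 3–5 of the named fact;
* `vanGeemenVerra2003_quaternionHodgeClasses_iff_general` — consequently the named fact is EQUIVALENT
  to its §4.8 (general-member) clause alone: that clause is its exact unproved residual.

Lemma 4.5 (`(A, ℚ(φ))` is of Weil type) is the tree's `HodgeTheory.isWeilType_of_anticomm`
(`HodgeTheory/WeilTypeOfQuaternionAction`); §4.8 (the Hodge ring of a GENERAL member) is NOT proved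
here, so the named fact itself stays a named fact. Consumers that use the fact only through Prop. 4.7
(e.g. the hypothesis `hV` of `Summit.…WeilTypeLadder.weilClassesOf_quaternionSixfold_le_algebraicClasses_of_floor`,
files `Summits/HodgeConjecture/HodgeConjecture/Theorems/WeilTypeLadderQuaternionSixfolds.lean`,
`…/WeilTypeLadderQuaternionicPrym.lean`) can be served by these theorems instead.

## Proof (our own road on the carriers; the paper argues with `H¹ ≅ W ⊗ U`, `W_F ⊗ ℂ ≅ det W ⊗ S^{2n}U`)

Write `Φ = φ^*`, `Ψ = χ^*` on `H¹ = H¹(A(ℂ); ℂ)`, `μ = i√a`, `ν = i√b`, `V₊ = ker(Φ - μ)` (dimension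
`2n`: `AbelianVarietyEndomorphismsHOne`). Since `ΦΨ = -ΨΦ`, `Ψ` maps `V₊` isomorphically onto
`V₋ = ker(Φ + μ)` (`WeilTypeOfQuaternionAction`); fix a basis `w₁, …, w_{2n}` of `V₊`, so that
`(w, Ψw)` is a basis of `H¹` (`exists_eigenframe`).

* **§A (generic algebra).** The multilinear expansion `f(αu + βv) = ∑ⱼ αʲβ^{N-j} dⱼ(u, v)` with
  `dⱼ = ∑_{#s = j} f(s.piecewise u v)`; joint eigenvectors with distinct joint characters are
  independent; a Vandermonde inversion (`Matrix.vandermonde`); the characters `(x+μ)ʲ(x-μ)^{N-j}`,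
  `x ∈ ℕ`, are pairwise distinct (`μ ≠ 0`).
* **§B.** The order `ℤ⟨φ, χ⟩ ∋ z = q₀ + q₁φ + q₂χ + q₃φχ` acts on `H¹` by `q₀ + q₁Φ + q₂Ψ + q₃ΦΨ`, hence
  maps `α₀w + β₀Ψw` (`w ∈ V₊`) to `α'w + β'Ψw` with `α', β'` INDEPENDENT of `w`
  (`map_quaternionElement_smul_add_smul`); `w ± ν⁻¹Ψw` are the `±ν`-eigenvectors of `Ψ`.
* **§C.** The wedges `Ω(α, β) = ⋀ᵢ (α wᵢ + β Ψwᵢ) ∈ H^{2n}` satisfy `z^*Ω(α₀, β₀) = Ω(α', β')`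
  (`map_cupPowOne`) and `Ω(α, β) = ∑ⱼ αʲ β^{2n-j} dⱼ` with `dⱼ` the sum of the MIXED WEDGES over the
  `j`-subsets (`wᵢ` for `i ∈ s`, `Ψwᵢ` for `i ∉ s`); `dⱼ` is a joint eigenclass of the test
  endomorphisms `(x + yφ)^*` with character `(x + yμ)ʲ(x - yμ)^{2n-j}`, the characters are distinct, and
  `dⱼ ≠ 0` — each mixed wedge is a member of the wedge basis of `H^{2n} = ⋀^{2n}H¹`
  (`Motives.AbelianVariety.hasExteriorCohomologyH1_complexPoints`, Mathlib
  `exteriorPower.ιMulti_family_linearIndependent_field`) for the frame ordered lexicographically as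
  `(i, wᵢ) < (i, Ψwᵢ) < (i+1, …)`, distinct subsets giving distinct members — so `d₀, …, d_{2n}` are
  linearly independent and `S := span(dⱼ)` has dimension `2n + 1`.
* **§D.** `E₊(φ) = ℂΩ(1,0)`, `E₋(φ) = ℂΩ(0,1)`, `E_±(χ) = ℂΩ(1, ±ν⁻¹)` (the Weil lines are lines,
  `weilClassesPlus_le_span_singleton`), so every translate of the two Weil planes lies in `S`:
  `W_F(ℚ(φ)) ⊗ ℂ ≤ S` and `W_F(ℚ(χ)) ⊗ ℂ ≤ S`. Conversely `(m + χ)^*Ω(1,0) = Ω(m, 1) = ∑ⱼ mʲ dⱼ`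
  for `m = 0, …, 2n` and Vandermonde give `S ≤ W_F(ℚ(φ)) ⊗ ℂ`. Hence `W_F(ℚ(φ)) ⊗ ℂ = S ⊇ W_F(ℚ(χ)) ⊗ ℂ`;
  the symmetric statement for the pair `(χ, φ)` (the orders `ℤ⟨φ, χ⟩ = ℤ⟨χ, φ⟩` coincide,
  `quaternionClasses_swap`) gives the reverse inclusion. `W_F ⊗ ℂ ⊆ Bⁿ ⊗ ℂ`: Lemma 4.5 makes
  `(A, ℚ(φ))` of Weil type, so `W_{ℚ(φ)} ⊗ ℂ` is spanned by rational `(n,n)`-classes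
  (`weilClassesOf_eq_span_isRationalClass`, `IsWeilType.isOfHodgeType_of_mem_weilClassesOf`), and
  pull-backs along endomorphisms preserve `Bⁿ ⊗ ℂ` (`hodgeClassSpan_map_le`).

## References

* [vanGeemenVerra2003QuaternionicPryms] B. van Geemen, A. Verra, *Quaternionic Pryms and Hodge
  classes*, Topology 42 (2003), 1.1, 2.1, Lemma 4.5, 4.6, Prop. 4.7.
* [vanGeemen1994HodgeAV] B. van Geemen, *An introduction to the Hodge conjecture for abelian
  varieties*, LNM 1594 (1994), 4.8–4.10, Lemma 5.2, proof of Thm. 6.12.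
* [LangeBirkenhake1992] H. Lange, Ch. Birkenhake, *Complex Abelian Varieties*, §1.1 (p. 19),
  Lemma 1.1.17.
-/

noncomputable section

open CategoryTheory Polynomial
open Literature.AlgebraicTopology.SingularHomology
open Literature.AlgebraicGeometry.HodgeTheory
open Literature.AlgebraicGeometry Literature.AlgebraicGeometry.Motives
open Literature.AlgebraicGeometry.VanGeemen1994 (hodgeClassSpan pullbackOne)
open Literature.Barriers.HodgeConjecture (divisorClassesSpan)

namespace Literature.AlgebraicGeometry.VanGeemenVerra2003

/-! ### A. Generic algebra -/

section Generic

/-- Multilinear expansion of `f(αu + βv)` over the subsets of the index type. [folklore] -/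
private theorem multilinear_add_smul_expand {R ι M N : Type*} [CommRing R] [Fintype ι] [DecidableEq ι]
    [AddCommGroup M] [Module R M] [AddCommGroup N] [Module R N]
    (f : MultilinearMap R (fun _ : ι => M) N) (α β : R) (u v : ι → M) :
    f (fun i => α • u i + β • v i) =
      ∑ s : Finset ι, (α ^ s.card * β ^ (Fintype.card ι - s.card)) • f (s.piecewise u v) := by
  have h1 : (fun i => α • u i + β • v i) = (fun i => α • u i) + (fun i => β • v i) := rfl
  rw [h1, MultilinearMap.map_add_univ]
  refine Finset.sum_congr rfl fun s _ => ?_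
  have h2 : s.piecewise (fun i => α • u i) (fun i => β • v i) =
      fun i => (s.piecewise (fun _ => α) (fun _ => β) i) • (s.piecewise u v i) := by
    funext i
    by_cases hi : i ∈ s
    · simp [Finset.piecewise_eq_of_mem _ _ _ hi]
    · simp [Finset.piecewise_eq_of_notMem _ _ _ hi]
  rw [h2, MultilinearMap.map_smul_univ, Finset.prod_piecewise, Finset.univ_inter, Finset.prod_const,
    Finset.prod_const, Finset.card_univ_sdiff]

/-- The same expansion, grouped by the cardinality of the subset. [folklore] -/
private theorem multilinear_add_smul_expand_card {R M N : Type*} [CommRing R] [AddCommGroup M] [Module R M]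
    [AddCommGroup N] [Module R N] {d : ℕ} (f : MultilinearMap R (fun _ : Fin d => M) N) (α β : R)
    (u v : Fin d → M) :
    f (fun i => α • u i + β • v i) =
      ∑ j : Fin (d + 1), (α ^ (j : ℕ) * β ^ (d - j)) •
        ∑ s ∈ Finset.powersetCard (j : ℕ) Finset.univ, f (s.piecewise u v) := by
  classical
  rw [multilinear_add_smul_expand]
  simp only [Fintype.card_fin]
  rw [← Finset.powerset_univ, Finset.powerset_card_disjiUnion, Finset.sum_disjiUnion, Finset.card_univ,
    Fintype.card_fin, Finset.sum_range]
  refine Finset.sum_congr rfl fun j _ => ?_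
  rw [Finset.smul_sum]
  refine Finset.sum_congr rfl fun s hs => ?_
  rw [(Finset.mem_powersetCard.1 hs).2]

/-- Joint eigenvectors of a family of operators with pairwise distinct joint characters: if a finite sum
of them vanishes then each summand vanishes. [folklore] -/
private theorem eq_zero_of_sum_eq_zero_of_jointEigen {F V P J : Type*} [Field F] [AddCommGroup V]
    [Module F V] (T : P → V →ₗ[F] V) (χ : J → P → F) (hχ : Function.Injective χ)
    (s : Finset J) (u : J → V) (hu : ∀ j ∈ s, ∀ p, T p (u j) = χ j p • u j)
    (h0 : ∑ j ∈ s, u j = 0) : ∀ j ∈ s, u j = 0 := by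
  classical
  induction s using Finset.induction_on generalizing u with
  | empty => simp
  | insert j₁ s hj₁ ih =>
    rw [Finset.sum_insert hj₁] at h0
    have hs : ∀ j ∈ s, u j = 0 := by
      intro j hj
      have hne : χ j₁ ≠ χ j := fun h => hj₁ (by rwa [hχ h])
      obtain ⟨p, hp⟩ := Function.ne_iff.mp hne
      have hT : χ j₁ p • u j₁ + ∑ j' ∈ s, χ j' p • u j' = 0 := by
        have h := congrArg (T p) h0
        rw [map_add, map_sum, map_zero, hu j₁ (Finset.mem_insert_self _ _) p,
          Finset.sum_congr rfl fun j' hj' => hu j' (Finset.mem_insert_of_mem hj') p] at h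
        exact h
      have hS : χ j₁ p • u j₁ + ∑ j' ∈ s, χ j₁ p • u j' = 0 := by
        rw [← Finset.smul_sum, ← smul_add, h0, smul_zero]
      have h1 : ∑ j' ∈ s, (χ j' p - χ j₁ p) • u j' = 0 := by
        have h2 : (χ j₁ p • u j₁ + ∑ j' ∈ s, χ j' p • u j') -
            (χ j₁ p • u j₁ + ∑ j' ∈ s, χ j₁ p • u j') = 0 := by rw [hT, hS, sub_zero]
        rw [add_sub_add_left_eq_sub, ← Finset.sum_sub_distrib] at h2
        simpa only [sub_smul] using h2
      have h3 := ih (fun j' => (χ j' p - χ j₁ p) • u j')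
        (fun j' hj' q => by rw [map_smul, hu j' (Finset.mem_insert_of_mem hj') q, smul_comm]) h1 j hj
      exact (smul_eq_zero.mp h3).resolve_left (sub_ne_zero.mpr (Ne.symm hp))
    have h4 : u j₁ = 0 := by
      rw [Finset.sum_eq_zero hs, add_zero] at h0
      exact h0
    intro j hj
    rcases Finset.mem_insert.mp hj with rfl | hj
    · exact h4
    · exact hs j hj

/-- Vandermonde extraction: if `∑ⱼ rₘʲ dⱼ ∈ M` for pairwise distinct nodes `rₘ` (as many as the `dⱼ`),
then every `dⱼ ∈ M`. [folklore] -/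
private theorem mem_of_vandermonde {V : Type*} [AddCommGroup V] [Module ℂ V] (M : Submodule ℂ V)
    {N : ℕ} (r : Fin N → ℂ) (hr : Function.Injective r) (d : Fin N → V)
    (h : ∀ m, ∑ j : Fin N, r m ^ (j : ℕ) • d j ∈ M) (j : Fin N) : d j ∈ M := by
  classical
  set A : Matrix (Fin N) (Fin N) ℂ := Matrix.vandermonde r with hA
  have hdet : IsUnit A.det := by
    rw [isUnit_iff_ne_zero, hA, Matrix.det_vandermonde_ne_zero_iff]
    exact hr
  have key : d j = ∑ m, A⁻¹ j m • ∑ j' : Fin N, r m ^ (j' : ℕ) • d j' := by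
    have hAj : ∀ (m j' : Fin N), r m ^ (j' : ℕ) = A m j' := fun m j' => by
      rw [hA, Matrix.vandermonde_apply]
    calc d j = ∑ j', (1 : Matrix (Fin N) (Fin N) ℂ) j j' • d j' := by
            rw [Finset.sum_eq_single j]
            · rw [Matrix.one_apply_eq, one_smul]
            · intro j' _ hj'
              rw [Matrix.one_apply_ne (Ne.symm hj'), zero_smul]
            · intro hj
              exact absurd (Finset.mem_univ j) hj
      _ = ∑ j', (A⁻¹ * A) j j' • d j' := by rw [Matrix.nonsing_inv_mul A hdet]
      _ = ∑ j', ∑ m, (A⁻¹ j m * A m j') • d j' := by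
            refine Finset.sum_congr rfl fun j' _ => ?_
            rw [Matrix.mul_apply, Finset.sum_smul]
      _ = ∑ m, ∑ j', (A⁻¹ j m * A m j') • d j' := Finset.sum_comm
      _ = ∑ m, A⁻¹ j m • ∑ j' : Fin N, r m ^ (j' : ℕ) • d j' := by
            refine Finset.sum_congr rfl fun m _ => ?_
            rw [Finset.smul_sum]
            refine Finset.sum_congr rfl fun j' _ => ?_
            rw [hAj, smul_smul]
  rw [key]
  exact Submodule.sum_mem _ fun m _ => Submodule.smul_mem _ _ (h m)

/-- The characters `(x + μ)ʲ (x - μ)ᴺ⁻ʲ` of `ℕ`, `μ ≠ 0`, are pairwise distinct: two of them agreeing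
at every natural number would be equal polynomials, and cancelling the common factors leaves
`(X - μ)ᵏ = (X + μ)ᵏ`, `k ≥ 1`, false at `X = μ`. [folklore] -/
private theorem exists_nat_charSeparating {μ : ℂ} (hμ : μ ≠ 0) {N j j' : ℕ} (hj : j ≤ N) (hj' : j' ≤ N)
    (hne : j ≠ j') :
    ∃ x : ℕ, ((x : ℂ) + μ) ^ j * ((x : ℂ) - μ) ^ (N - j) ≠
      ((x : ℂ) + μ) ^ j' * ((x : ℂ) - μ) ^ (N - j') := by
  wlog hlt : j < j' generalizing j j' with H
  · obtain ⟨x, hx⟩ := H hj' hj (Ne.symm hne) (lt_of_le_of_ne (not_lt.mp hlt) (Ne.symm hne))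
    exact ⟨x, Ne.symm hx⟩
  by_contra hall
  push Not at hall
  set P : ℂ[X] := (X + C μ) ^ j * (X - C μ) ^ (N - j) with hPdef
  set Q : ℂ[X] := (X + C μ) ^ j' * (X - C μ) ^ (N - j') with hQdef
  have hPQ : P = Q := by
    apply Polynomial.eq_of_infinite_eval_eq
    refine Set.Infinite.mono ?_ (Set.infinite_range_of_injective (Nat.cast_injective (R := ℂ)))
    rintro _ ⟨x, rfl⟩
    simp only [Set.mem_setOf_eq, hPdef, hQdef, eval_mul, eval_pow, eval_add, eval_sub, eval_X, eval_C]
    exact hall x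
  have e1 : N - j = (j' - j) + (N - j') := by omega
  have hP : P = (X + C μ) ^ j * ((X - C μ) ^ (j' - j) * (X - C μ) ^ (N - j')) := by
    rw [hPdef, ← pow_add, ← e1]
  have hQ : Q = (X + C μ) ^ j * ((X + C μ) ^ (j' - j) * (X - C μ) ^ (N - j')) := by
    rw [hQdef, ← mul_assoc, ← pow_add, Nat.add_sub_cancel' hlt.le]
  have hne1 : ((X + C μ : ℂ[X])) ^ j ≠ 0 := pow_ne_zero _ (X_add_C_ne_zero μ)
  have hne2 : ((X - C μ : ℂ[X])) ^ (N - j') ≠ 0 := pow_ne_zero _ (X_sub_C_ne_zero μ)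
  have h3 : ((X - C μ : ℂ[X])) ^ (j' - j) = (X + C μ) ^ (j' - j) := by
    have h := hPQ
    rw [hP, hQ] at h
    exact mul_right_cancel₀ hne2 (mul_left_cancel₀ hne1 h)
  have h4 := congrArg (Polynomial.eval μ) h3
  simp only [eval_pow, eval_sub, eval_add, eval_X, eval_C, sub_self] at h4
  rw [zero_pow (Nat.sub_ne_zero_of_lt hlt)] at h4
  have h5 : μ + μ ≠ 0 := by rwa [Ne, add_self_eq_zero]
  exact absurd h4.symm (pow_ne_zero _ h5)

/-- If `(u, v)` is a linearly independent family (indexed by `ι ⊕ ι`), so is `i ↦ α uᵢ + β vᵢ` for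
`(α, β) ≠ (0, 0)`. [folklore] -/
private theorem linearIndependent_smul_add_smul {ι V : Type*} [Fintype ι] [AddCommGroup V] [Module ℂ V]
    {u v : ι → V} (hli : LinearIndependent ℂ (Sum.elim u v)) {α β : ℂ} (h : α ≠ 0 ∨ β ≠ 0) :
    LinearIndependent ℂ (fun i => α • u i + β • v i) := by
  rw [Fintype.linearIndependent_iff] at hli ⊢
  intro g hg i
  have h2 := hli (Sum.elim (fun i => g i * α) (fun i => g i * β)) (by
    rw [Fintype.sum_sum_type]
    simp only [Sum.elim_inl, Sum.elim_inr]
    rw [← hg]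
    simp only [smul_add, smul_smul, Finset.sum_add_distrib])
  rcases h with hα | hβ
  · have h3 := h2 (Sum.inl i)
    simp only [Sum.elim_inl] at h3
    exact (mul_eq_zero.mp h3).resolve_right hα
  · have h3 := h2 (Sum.inr i)
    simp only [Sum.elim_inr] at h3
    exact (mul_eq_zero.mp h3).resolve_right hβ

end Generic

/-! ### B. The order `ℤ⟨φ, χ⟩` acting on `H¹ = V₊ ⊕ χ^* V₊` -/

section HOne

variable {A : AbelianVariety ℂ} {φ χ : A ⟶ A} {b : ℕ}

/-- `(f + g)^* c = f^* c + g^* c` on `H¹`, applied form. [cite: LangeBirkenhake1992, §1.1 (p. 19)] -/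
private theorem map_add_one_apply (f g : A ⟶ A) (c : complexBetti A.X 1) :
    complexBetti.map (f + g).hom.hom.hom 1 c =
      complexBetti.map f.hom.hom.hom 1 c + complexBetti.map g.hom.hom.hom 1 c := by
  rw [complexBetti_map_add_one]
  rfl

/-- `(m • f)^* c = m • f^* c` on `H¹`, applied form, `m : ℤ`. [cite: LangeBirkenhake1992, §1.1 (p. 19)] -/
private theorem map_zsmul_one_apply (m : ℤ) (f : A ⟶ A) (c : complexBetti A.X 1) :
    complexBetti.map (m • f).hom.hom.hom 1 c = (m : ℂ) • complexBetti.map f.hom.hom.hom 1 c := by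
  rw [complexBetti_map_zsmul_one, Int.cast_smul_eq_zsmul]
  rfl

/-- **The order `ℤ⟨φ, χ⟩` acts on `H¹(A(ℂ); ℂ)` by `(q₀ + q₁φ + q₂χ + q₃φχ)^* = q₀ + q₁φ^* + q₂χ^* + q₃φ^*χ^*`**
(additivity and contravariance of `f ↦ f^*` on `H¹`). [cite: vanGeemenVerra2003QuaternionicPryms, 1.1 and 2.1]
[cite: LangeBirkenhake1992, §1.1 (p. 19)] -/
theorem map_quaternionElement_one_apply (q : Fin 4 → ℤ) (c : complexBetti A.X 1) :
    complexBetti.map (quaternionElement A φ χ q).hom.hom.hom 1 c =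
      (q 0 : ℂ) • c + (q 1 : ℂ) • complexBetti.map φ.hom.hom.hom 1 c +
        (q 2 : ℂ) • complexBetti.map χ.hom.hom.hom 1 c +
        (q 3 : ℂ) • complexBetti.map φ.hom.hom.hom 1 (complexBetti.map χ.hom.hom.hom 1 c) := by
  unfold quaternionElement
  rw [map_add_one_apply, map_add_one_apply, map_add_one_apply, map_zsmul_one_apply,
    map_zsmul_one_apply, map_zsmul_one_apply, map_zsmul_one_apply, complexBetti_map_map_hom φ χ c]
  congr 3
  change (q 0 : ℂ) • complexBetti.map (𝟙 A.X) 1 c = _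
  rw [complexBetti.map_id]
  rfl

/-- **`z^*` on `V₊ ⊕ χ^* V₊`**: for `w` in the `μ`-eigenspace of `φ^*`, `χ ≫ χ = -b`, `φχ = -χφ`, and
`z = q₀ + q₁φ + q₂χ + q₃φχ ∈ ℤ⟨φ, χ⟩`,
`z^*(α₀ w + β₀ χ^*w) = (α₀(q₀ + q₁μ) - β₀ b (q₂ + q₃μ)) w + (α₀(q₂ - q₃μ) + β₀(q₀ - q₁μ)) χ^*w`
(`φ^*w = μw`, `φ^*χ^*w = -μχ^*w`, `χ^*χ^*w = -bw`).
[cite: vanGeemenVerra2003QuaternionicPryms, proof of Lemma 4.5 and 4.6] -/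
theorem map_quaternionElement_smul_add_smul (hχ : χ ≫ χ = -(b • 𝟙 A)) (hφχ : φ ≫ χ = -(χ ≫ φ))
    {μ : ℂ} {w : complexBetti A.X 1}
    (hw : w ∈ Module.End.eigenspace (complexBetti.map φ.hom.hom.hom 1).hom μ)
    (q : Fin 4 → ℤ) (α₀ β₀ : ℂ) :
    complexBetti.map (quaternionElement A φ χ q).hom.hom.hom 1
        (α₀ • w + β₀ • complexBetti.map χ.hom.hom.hom 1 w) =
      (α₀ * ((q 0 : ℂ) + (q 1 : ℂ) * μ) - β₀ * (b : ℂ) * ((q 2 : ℂ) + (q 3 : ℂ) * μ)) • w +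
        (α₀ * ((q 2 : ℂ) - (q 3 : ℂ) * μ) + β₀ * ((q 0 : ℂ) - (q 1 : ℂ) * μ)) •
          complexBetti.map χ.hom.hom.hom 1 w := by
  have hΦ : complexBetti.map φ.hom.hom.hom 1 w = μ • w := Module.End.mem_eigenspace_iff.mp hw
  have hΦΨ : complexBetti.map φ.hom.hom.hom 1 (complexBetti.map χ.hom.hom.hom 1 w) =
      -μ • complexBetti.map χ.hom.hom.hom 1 w :=
    Module.End.mem_eigenspace_iff.mp (map_mem_eigenspace_neg_of_anticomm hφχ hw)
  have hΨΨ : complexBetti.map χ.hom.hom.hom 1 (complexBetti.map χ.hom.hom.hom 1 w) = -((b : ℂ) • w) :=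
    complexBetti_map_map_one_of_comp_self hχ w
  rw [map_quaternionElement_one_apply]
  simp only [map_add, map_smul, map_neg, hΨΨ, hΦΨ, hΦ]
  module

/-- **The `χ^*`-eigenvectors inside `V₊ ⊕ χ^* V₊`**: with `ν² = -b` (`ν ≠ 0`) and `χ^*χ^* w = -b w`,
`w + ν⁻¹ χ^* w` is a `ν`-eigenvector of `χ^*` ("the eigenspaces of `x ∈ K` are permuted by `j`").
[cite: vanGeemenVerra2003QuaternionicPryms, proof of Lemma 4.5] -/
theorem add_smul_map_mem_eigenspace (hχ : χ ≫ χ = -(b • 𝟙 A)) {ν : ℂ} (hν : ν ^ 2 = -(b : ℂ))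
    (hν0 : ν ≠ 0) (w : complexBetti A.X 1) :
    w + ν⁻¹ • complexBetti.map χ.hom.hom.hom 1 w ∈
      Module.End.eigenspace (complexBetti.map χ.hom.hom.hom 1).hom ν := by
  rw [Module.End.mem_eigenspace_iff]
  change complexBetti.map χ.hom.hom.hom 1 (w + ν⁻¹ • complexBetti.map χ.hom.hom.hom 1 w) = _
  rw [map_add, map_smul, complexBetti_map_map_one_of_comp_self hχ w, smul_add, smul_smul,
    mul_inv_cancel₀ hν0, one_smul, add_comm, smul_neg]
  congr 1
  have hb : (b : ℂ) = -(ν * ν) := by rw [← sq, hν, neg_neg]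
  rw [← neg_smul, smul_smul, hb, neg_mul_neg, ← mul_assoc, inv_mul_cancel₀ hν0, one_mul]

/-- … and `w - ν⁻¹ χ^* w` is a `(-ν)`-eigenvector of `χ^*`. [cite: vanGeemenVerra2003QuaternionicPryms, proof of Lemma 4.5] -/
theorem sub_smul_map_mem_eigenspace_neg (hχ : χ ≫ χ = -(b • 𝟙 A)) {ν : ℂ} (hν : ν ^ 2 = -(b : ℂ))
    (hν0 : ν ≠ 0) (w : complexBetti A.X 1) :
    w + (-ν)⁻¹ • complexBetti.map χ.hom.hom.hom 1 w ∈
      Module.End.eigenspace (complexBetti.map χ.hom.hom.hom 1).hom (-ν) :=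
  add_smul_map_mem_eigenspace hχ (by rw [neg_sq, hν]) (neg_ne_zero.mpr hν0) w

end HOne


/-! ### C. The mixed wedges `d_j` of an eigenframe -/

section Wedge

variable {A : AbelianVariety ℂ} {φ χ : A ⟶ A} {n b : ℕ} {μ : ℂ}
  (w : Fin (2 * n) → complexBetti A.X 1)

/-- **Translates of the wedges `⋀ᵢ(α₀wᵢ + β₀χ^*wᵢ)` by the order `ℤ⟨φ, χ⟩`** are again of this shape, with
the coefficients of `map_quaternionElement_smul_add_smul` (pull-back is multiplicative, `map_cupPowOne`).
[cite: vanGeemenVerra2003QuaternionicPryms, 4.6 and proof of Prop. 4.7] -/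
theorem map_quaternionElement_cupPowOne (hχ : χ ≫ χ = -(b • 𝟙 A)) (hφχ : φ ≫ χ = -(χ ≫ φ))
    (hw : ∀ i, w i ∈ Module.End.eigenspace (complexBetti.map φ.hom.hom.hom 1).hom μ)
    (q : Fin 4 → ℤ) (α₀ β₀ : ℂ) :
    complexBetti.map (quaternionElement A φ χ q).hom.hom.hom (2 * n)
        (cupPowOne ℂ (ComplexPoints A.X) (2 * n)
          (fun i => α₀ • w i + β₀ • complexBetti.map χ.hom.hom.hom 1 (w i))) =
      cupPowOne ℂ (ComplexPoints A.X) (2 * n)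
        (fun i => (α₀ * ((q 0 : ℂ) + (q 1 : ℂ) * μ) - β₀ * (b : ℂ) * ((q 2 : ℂ) + (q 3 : ℂ) * μ)) • w i +
          (α₀ * ((q 2 : ℂ) - (q 3 : ℂ) * μ) + β₀ * ((q 0 : ℂ) - (q 1 : ℂ) * μ)) •
            complexBetti.map χ.hom.hom.hom 1 (w i)) := by
  change singularCohomology.map ℂ ℂ (AlgPoints.mapContinuous (L := ℂ) _) (2 * n)
    (cupPowOne ℂ _ (2 * n) _) = _
  rw [map_cupPowOne]
  congr 1
  funext i
  exact map_quaternionElement_smul_add_smul hχ hφχ (hw i) q α₀ β₀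

/-- **The test endomorphisms `(x + yφ)^*` act on the mixed wedge of a subset `s` (factors `wᵢ`, `i ∈ s`,
and `χ^*wᵢ`, `i ∉ s`) by the character `(x + yμ)^{#s} (x - yμ)^{2n - #s}`** (`wᵢ ∈ V_μ`, `χ^*wᵢ ∈ V_{-μ}`).
[cite: vanGeemenVerra2003QuaternionicPryms, proof of Lemma 4.5] [cite: vanGeemen1994HodgeAV, 4.8–4.9] -/
theorem map_test_cupPowOne_piecewise (hφχ : φ ≫ χ = -(χ ≫ φ))
    (hw : ∀ i, w i ∈ Module.End.eigenspace (complexBetti.map φ.hom.hom.hom 1).hom μ)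
    (s : Finset (Fin (2 * n))) (x y : ℕ) :
    complexBetti.map (x • 𝟙 A + y • φ).hom.hom.hom (2 * n)
        (cupPowOne ℂ (ComplexPoints A.X) (2 * n)
          (s.piecewise w (fun i => complexBetti.map χ.hom.hom.hom 1 (w i)))) =
      (((x : ℂ) + (y : ℂ) * μ) ^ s.card * ((x : ℂ) - (y : ℂ) * μ) ^ (2 * n - s.card)) •
        cupPowOne ℂ (ComplexPoints A.X) (2 * n)
          (s.piecewise w (fun i => complexBetti.map χ.hom.hom.hom 1 (w i))) := by
  classical
  change singularCohomology.map ℂ ℂ (AlgPoints.mapContinuous (L := ℂ) _) (2 * n)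
    (cupPowOne ℂ _ (2 * n) _) = _
  rw [map_cupPowOne]
  have hfac : (fun i => singularCohomology.map ℂ ℂ
      (AlgPoints.mapContinuous (L := ℂ) (x • 𝟙 A + y • φ).hom.hom.hom) 1
        (s.piecewise w (fun i => complexBetti.map χ.hom.hom.hom 1 (w i)) i)) =
      fun i => (s.piecewise (fun _ => (x : ℂ) + (y : ℂ) * μ) (fun _ => (x : ℂ) - (y : ℂ) * μ) i) •
        s.piecewise w (fun i => complexBetti.map χ.hom.hom.hom 1 (w i)) i := by
    funext i
    by_cases hi : i ∈ s
    · rw [Finset.piecewise_eq_of_mem _ _ _ hi, Finset.piecewise_eq_of_mem _ _ _ hi]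
      exact complexBetti_map_nsmul_id_add_nsmul_one_of_mem_eigenspace (hw i) x y
    · rw [Finset.piecewise_eq_of_notMem _ _ _ hi, Finset.piecewise_eq_of_notMem _ _ _ hi,
        show ((x : ℂ) - (y : ℂ) * μ) = (x : ℂ) + (y : ℂ) * (-μ) by ring]
      exact complexBetti_map_nsmul_id_add_nsmul_one_of_mem_eigenspace
        (map_mem_eigenspace_neg_of_anticomm hφχ (hw i)) x y
  rw [hfac, MultilinearMap.map_smul_univ, Finset.prod_piecewise, Finset.univ_inter, Finset.prod_const,
    Finset.prod_const, Finset.card_univ_sdiff, Fintype.card_fin]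

/-- **`d_j`, the sum of the mixed wedges over the subsets of cardinality `j`, is a joint eigenclass of the
test endomorphisms with character `(x + yμ)ʲ (x - yμ)²ⁿ⁻ʲ`.**
[cite: vanGeemenVerra2003QuaternionicPryms, proof of Prop. 4.7] [cite: vanGeemen1994HodgeAV, 4.8–4.9] -/
theorem sum_cupPowOne_piecewise_mem_pullbackEigenclasses (hφχ : φ ≫ χ = -(χ ≫ φ))
    (hw : ∀ i, w i ∈ Module.End.eigenspace (complexBetti.map φ.hom.hom.hom 1).hom μ) (j : ℕ) :
    (∑ s ∈ Finset.powersetCard j Finset.univ,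
        cupPowOne ℂ (ComplexPoints A.X) (2 * n)
          (s.piecewise w (fun i => complexBetti.map χ.hom.hom.hom 1 (w i)))) ∈
      pullbackEigenclasses A φ (2 * n)
        (fun x y => ((x : ℂ) + (y : ℂ) * μ) ^ j * ((x : ℂ) - (y : ℂ) * μ) ^ (2 * n - j)) := by
  classical
  rw [mem_pullbackEigenclasses_iff]
  intro x y
  change complexBetti.map (x • 𝟙 A + y • φ).hom.hom.hom (2 * n) (∑ s ∈ _, _) = _
  rw [map_sum, Finset.smul_sum]
  refine Finset.sum_congr rfl fun s hs => ?_
  rw [map_test_cupPowOne_piecewise w hφχ hw s x y, (Finset.mem_powersetCard.1 hs).2]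

/-- **The `d_j`, `j = 0, …, 2n`, are linearly independent** as soon as they are non-zero: their joint
characters under the test endomorphisms are pairwise distinct (`μ ≠ 0`).
[cite: vanGeemenVerra2003QuaternionicPryms, proof of Prop. 4.7] -/
theorem linearIndependent_sum_cupPowOne_piecewise (hφχ : φ ≫ χ = -(χ ≫ φ))
    (hw : ∀ i, w i ∈ Module.End.eigenspace (complexBetti.map φ.hom.hom.hom 1).hom μ) (hμ : μ ≠ 0)
    (hne : ∀ j : Fin (2 * n + 1), (∑ s ∈ Finset.powersetCard (j : ℕ) Finset.univ,
        cupPowOne ℂ (ComplexPoints A.X) (2 * n)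
          (s.piecewise w (fun i => complexBetti.map χ.hom.hom.hom 1 (w i)))) ≠ 0) :
    LinearIndependent ℂ (fun j : Fin (2 * n + 1) => ∑ s ∈ Finset.powersetCard (j : ℕ) Finset.univ,
        cupPowOne ℂ (ComplexPoints A.X) (2 * n)
          (s.piecewise w (fun i => complexBetti.map χ.hom.hom.hom 1 (w i)))) := by
  classical
  rw [Fintype.linearIndependent_iff]
  intro g hg j
  set d : Fin (2 * n + 1) → complexBetti A.X (2 * n) := fun j => ∑ s ∈ Finset.powersetCard (j : ℕ) Finset.univ,
        cupPowOne ℂ (ComplexPoints A.X) (2 * n)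
          (s.piecewise w (fun i => complexBetti.map χ.hom.hom.hom 1 (w i))) with hd
  let T : ℕ × ℕ → complexBetti A.X (2 * n) →ₗ[ℂ] complexBetti A.X (2 * n) := fun p =>
    (complexBetti.map (p.1 • 𝟙 A + p.2 • φ).hom.hom.hom (2 * n)).hom
  let ch : Fin (2 * n + 1) → ℕ × ℕ → ℂ := fun j p =>
    ((p.1 : ℂ) + (p.2 : ℂ) * μ) ^ (j : ℕ) * ((p.1 : ℂ) - (p.2 : ℂ) * μ) ^ (2 * n - j)
  have hinj : Function.Injective ch := by
    intro j j' hjj'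
    by_contra hne'
    obtain ⟨x, hx⟩ := exists_nat_charSeparating hμ (N := 2 * n) (j := (j : ℕ)) (j' := (j' : ℕ))
      (by omega) (by omega) (fun h => hne' (Fin.ext h))
    apply hx
    have h1 := congrFun hjj' (x, 1)
    simpa [ch] using h1
  have heig : ∀ j ∈ (Finset.univ : Finset (Fin (2 * n + 1))), ∀ p, T p (g j • d j) = ch j p • (g j • d j) := by
    intro j _ p
    have h1 := (mem_pullbackEigenclasses_iff.mp
      (sum_cupPowOne_piecewise_mem_pullbackEigenclasses w hφχ hw (j : ℕ))) p.1 p.2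
    rw [map_smul, smul_comm]
    congr 1
  have key := eq_zero_of_sum_eq_zero_of_jointEigen T ch hinj Finset.univ (fun j => g j • d j) heig hg j
    (Finset.mem_univ j)
  exact (smul_eq_zero.mp key).resolve_right (hne j)

/-- **`d_j ≠ 0`** for `j ≤ 2n` when the frame `(w, χ^*w)` is linearly independent: each mixed wedge is a
member of the wedge basis of `H²ⁿ(A(ℂ); ℂ) = ⋀²ⁿ H¹` built on an ordered basis extending the frame
(index `i ↦ (i, wᵢ or χ^*wᵢ)` in lexicographic order), distinct subsets giving distinct members.
[cite: vanGeemenVerra2003QuaternionicPryms, proof of Prop. 4.7] [cite: LangeBirkenhake1992, Lemma 1.1.17] -/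
theorem sum_cupPowOne_piecewise_ne_zero
    (hli : LinearIndependent ℂ (Sum.elim w (fun i => complexBetti.map χ.hom.hom.hom 1 (w i))))
    {j : ℕ} (hj : j ≤ 2 * n) :
    (∑ s ∈ Finset.powersetCard j Finset.univ,
        cupPowOne ℂ (ComplexPoints A.X) (2 * n)
          (s.piecewise w (fun i => complexBetti.map χ.hom.hom.hom 1 (w i)))) ≠ 0 := by
  classical
  have hΛ := Motives.AbelianVariety.hasExteriorCohomologyH1_complexPoints A
  -- the frame, indexed by `Fin (2n) × Bool` in lexicographic order
  let v : Lex (Fin (2 * n) × Bool) → complexBetti A.X 1 := fun p =>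
    if (ofLex p).2 then complexBetti.map χ.hom.hom.hom 1 (w (ofLex p).1) else w (ofLex p).1
  have hv : LinearIndependent ℂ v := by
    let g : Lex (Fin (2 * n) × Bool) → Fin (2 * n) ⊕ Fin (2 * n) := fun p =>
      if (ofLex p).2 then Sum.inr (ofLex p).1 else Sum.inl (ofLex p).1
    have hg : Function.Injective g := by
      intro p p' h
      have h2 : ofLex p = ofLex p' := by
        cases hp : (ofLex p).2 <;> cases hp' : (ofLex p').2 <;>
          simp only [g, hp, hp', Bool.false_eq_true, ↓reduceIte, Sum.inl.injEq, Sum.inr.injEq,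
            reduceCtorEq] at h <;>
          exact Prod.ext h (by rw [hp, hp'])
      exact ofLex.injective h2
    have hvg : v = Sum.elim w (fun i => complexBetti.map χ.hom.hom.hom 1 (w i)) ∘ g := by
      funext p
      by_cases hp : (ofLex p).2 <;> simp [v, g, hp]
    rw [hvg]
    exact hli.comp g hg
  -- the order embeddings selecting the factors of the mixed wedges
  let e : Finset (Fin (2 * n)) → (Fin (2 * n) ↪o Lex (Fin (2 * n) × Bool)) := fun s =>
    OrderEmbedding.ofStrictMono (fun i => toLex (i, decide (i ∉ s)))
      (fun i i' h => Prod.Lex.toLex_lt_toLex.2 (Or.inl h))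
  let T : Finset (Fin (2 * n)) → Set.powersetCard (Lex (Fin (2 * n) × Bool)) (2 * n) := fun s =>
    Set.powersetCard.ofFinEmbEquiv (e s)
  have hT : Function.Injective T := by
    have key : ∀ (s : Finset (Fin (2 * n))) (i : Fin (2 * n)), i ∈ s ↔ toLex (i, false) ∈ T s := by
      intro s i
      rw [Set.powersetCard.mem_ofFinEmbEquiv_iff_mem_range]
      constructor
      · intro hi
        exact ⟨i, by simp [e, hi]⟩
      · rintro ⟨i', hi'⟩
        have h1 : toLex (i', decide (i' ∉ s)) = toLex (i, false) := hi'
        have h2 := toLex.injective h1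
        rw [Prod.mk.injEq] at h2
        obtain ⟨rfl, h3⟩ := h2
        simpa using h3
    intro s s' h
    ext i
    rw [key s, key s', h]
  have hcls : ∀ s : Finset (Fin (2 * n)),
      cupPowOne ℂ (ComplexPoints A.X) (2 * n)
          (s.piecewise w (fun i => complexBetti.map χ.hom.hom.hom 1 (w i))) =
        wedgeToCup ℂ (ComplexPoints A.X) (2 * n) (exteriorPower.ιMulti_family ℂ (2 * n) v (T s)) := by
    intro s
    rw [exteriorPower.ιMulti_family,
      show Set.powersetCard.ofFinEmbEquiv.symm (T s) = e s from Equiv.symm_apply_apply _ _,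
      wedgeToCup_ιMulti]
    congr 1
    funext i
    change s.piecewise w (fun i => complexBetti.map χ.hom.hom.hom 1 (w i)) i = v (toLex (i, decide (i ∉ s)))
    by_cases hi : i ∈ s <;> simp [v, hi]
  have hF : LinearIndependent ℂ (fun s : Finset (Fin (2 * n)) =>
      wedgeToCup ℂ (ComplexPoints A.X) (2 * n) (exteriorPower.ιMulti_family ℂ (2 * n) v (T s))) := by
    have h1 := (exteriorPower.ιMulti_family_linearIndependent_field (n := 2 * n) hv).map'
      (wedgeToCup ℂ (ComplexPoints A.X) (2 * n)) (LinearMap.ker_eq_bot.2 (hΛ (2 * n)).1)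
    exact h1.comp T hT
  intro h0
  rw [Finset.sum_congr rfl (fun s _ => hcls s)] at h0
  have h2 := (linearIndependent_iff'.mp hF) (Finset.powersetCard j Finset.univ) (fun _ => (1 : ℂ))
    (by simpa using h0)
  obtain ⟨s₀, hs₀⟩ : (Finset.powersetCard j (Finset.univ : Finset (Fin (2 * n)))).Nonempty :=
    Finset.powersetCard_nonempty.2 (by simpa using hj)
  exact one_ne_zero (h2 s₀ hs₀)

/-- **Wedges of eigenvectors of `ψ^*` for `i√d` lie in the Weil line `E₊(ψ)`** (the test endomorphisms
`(x + yψ)^*` are multiplicative and act by `x + yi√d` on each factor).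
[cite: vanGeemen1994HodgeAV, 4.9 and proof of Thm. 6.12] -/
theorem cupPowOne_mem_weilClassesPlus {ψ : A ⟶ A} {d : ℕ} {f : Fin (2 * n) → complexBetti A.X 1}
    (hf : ∀ i, f i ∈ Module.End.eigenspace (complexBetti.map ψ.hom.hom.hom 1).hom
      (Complex.I * (Real.sqrt d : ℂ))) :
    cupPowOne ℂ (ComplexPoints A.X) (2 * n) f ∈ weilClassesPlus A ψ n d := by
  rw [mem_weilClassesPlus_iff]
  intro x y
  rw [map_cupPowOne]
  have hfac : (fun i => singularCohomology.map ℂ ℂ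
      (AlgPoints.mapContinuous (L := ℂ) (x • 𝟙 A + y • ψ).hom.hom.hom) 1 (f i)) =
      fun i => ((x : ℂ) + (y : ℂ) * (Complex.I * (Real.sqrt d : ℂ))) • f i := by
    funext i
    exact complexBetti_map_nsmul_id_add_nsmul_one_of_mem_eigenspace (hf i) x y
  rw [hfac, MultilinearMap.map_smul_univ, Finset.prod_const, Finset.card_univ, Fintype.card_fin, ← mul_assoc]

/-- **Wedges of eigenvectors of `ψ^*` for `-i√d` lie in the Weil line `E₋(ψ)`.**
[cite: vanGeemen1994HodgeAV, 4.9 and proof of Thm. 6.12] -/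
theorem cupPowOne_mem_weilClassesMinus {ψ : A ⟶ A} {d : ℕ} {f : Fin (2 * n) → complexBetti A.X 1}
    (hf : ∀ i, f i ∈ Module.End.eigenspace (complexBetti.map ψ.hom.hom.hom 1).hom
      (-(Complex.I * (Real.sqrt d : ℂ)))) :
    cupPowOne ℂ (ComplexPoints A.X) (2 * n) f ∈ weilClassesMinus A ψ n d := by
  rw [mem_weilClassesMinus_iff]
  intro x y
  rw [map_cupPowOne]
  have hfac : (fun i => singularCohomology.map ℂ ℂ
      (AlgPoints.mapContinuous (L := ℂ) (x • 𝟙 A + y • ψ).hom.hom.hom) 1 (f i)) =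
      fun i => ((x : ℂ) + (y : ℂ) * (-(Complex.I * (Real.sqrt d : ℂ)))) • f i := by
    funext i
    exact complexBetti_map_nsmul_id_add_nsmul_one_of_mem_eigenspace (hf i) x y
  rw [hfac, MultilinearMap.map_smul_univ, Finset.prod_const, Finset.card_univ, Fintype.card_fin, mul_neg,
    ← sub_eq_add_neg, ← mul_assoc]

end Wedge

/-! ### D. Proposition 4.7 -/

section Prop47

variable {A : AbelianVariety ℂ} {φ χ : A ⟶ A} {n a b : ℕ}

/-- **Swapping the generators of the order**: `q₀ + q₁χ + q₂φ + q₃χφ = q₀ + q₂φ + q₁χ - q₃φχ` (`χφ = -φχ`).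
[cite: vanGeemenVerra2003QuaternionicPryms, 1.1 (`ij = -ji = k`)] -/
theorem quaternionElement_swap (hφχ : φ ≫ χ = -(χ ≫ φ)) (q : Fin 4 → ℤ) :
    quaternionElement A χ φ q = quaternionElement A φ χ ![q 0, q 2, q 1, -q 3] := by
  simp only [quaternionElement, Matrix.cons_val_zero, Matrix.cons_val_one, Matrix.cons_val]
  rw [comp_eq_neg_comp_of_anticomm hφχ, smul_neg, neg_smul]
  abel

/-- **`W_F ⊗ ℂ` does not depend on the order of the generators `φ, χ` of the order `ℤ⟨φ, χ⟩`** (the two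
orders `ℤ⟨φ, χ⟩`, `ℤ⟨χ, φ⟩` coincide). [cite: vanGeemenVerra2003QuaternionicPryms, 4.6] -/
theorem quaternionClasses_swap (hφχ : φ ≫ χ = -(χ ≫ φ)) (ψ : A ⟶ A) (d : ℕ) :
    quaternionClasses A φ χ ψ n d = quaternionClasses A χ φ ψ n d := by
  unfold quaternionClasses
  apply le_antisymm
  · refine iSup_le fun q => ?_
    rw [quaternionElement_swap (comp_eq_neg_comp_of_anticomm hφχ) q]
    exact le_iSup (fun q' => (weilClassesOf A ψ n d).map
      (complexBetti.map (quaternionElement A χ φ q').hom.hom.hom (2 * n)).hom) _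
  · refine iSup_le fun q => ?_
    rw [quaternionElement_swap hφχ q]
    exact le_iSup (fun q' => (weilClassesOf A ψ n d).map
      (complexBetti.map (quaternionElement A φ χ q').hom.hom.hom (2 * n)).hom) _

/-- **An eigenframe**: a basis `w` of `V₊ = ker(φ^* - i√a)` (of dimension `2n` when `dim A = 2n`) together
with `χ^* w`, a basis of `V₋`; the concatenated family is linearly independent (`V₊ ∩ V₋ = 0`, `χ^*`
injective on `H¹`). [cite: vanGeemenVerra2003QuaternionicPryms, proof of Lemma 4.5]
[cite: vanGeemen1994HodgeAV, proof of Lemma 5.2] -/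
theorem exists_eigenframe (ha : 0 < a) (hb : 0 < b) (hA : A.dim = 2 * n)
    (hφ : φ ≫ φ = -(a • 𝟙 A)) (hχ : χ ≫ χ = -(b • 𝟙 A)) (hφχ : φ ≫ χ = -(χ ≫ φ)) :
    ∃ w : Fin (2 * n) → complexBetti A.X 1,
      (∀ i, w i ∈ Module.End.eigenspace (complexBetti.map φ.hom.hom.hom 1).hom
        (Complex.I * (Real.sqrt a : ℂ))) ∧
      LinearIndependent ℂ (Sum.elim w (fun i => complexBetti.map χ.hom.hom.hom 1 (w i))) := by
  classical
  haveI := finite_complexBetti_abelianVariety A 1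
  have hb₁ : Module.finrank ℂ (complexBetti A.X 1) = 2 * (2 * n) := by
    rw [Motives.AbelianVariety.finrank_complexBetti_one, hA]
  have hVp : Module.finrank ℂ (Module.End.eigenspace (complexBetti.map φ.hom.hom.hom 1).hom
      (Complex.I * (Real.sqrt a : ℂ))) = 2 * n := by
    have h := two_mul_finrank_eigenspace_eq ha hφ
    rw [hb₁] at h
    omega
  let bV := Module.finBasisOfFinrankEq ℂ _ hVp
  refine ⟨fun i => (bV i : complexBetti A.X 1), fun i => (bV i).2, ?_⟩
  have hwli : LinearIndependent ℂ (fun i => (bV i : complexBetti A.X 1)) :=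
    bV.linearIndependent.map' (Submodule.subtype _) (Submodule.ker_subtype _)
  have hΨinj : LinearMap.ker (complexBetti.map χ.hom.hom.hom 1).hom = ⊥ :=
    LinearMap.ker_eq_bot.2 (complexBetti_map_one_injective_of_comp_self hχ hb)
  refine LinearIndependent.sum_type hwli (hwli.map' _ hΨinj) ?_
  have h1 : Submodule.span ℂ (Set.range fun i => (bV i : complexBetti A.X 1)) ≤
      Module.End.eigenspace (complexBetti.map φ.hom.hom.hom 1).hom (Complex.I * (Real.sqrt a : ℂ)) :=
    Submodule.span_le.2 (by rintro _ ⟨i, rfl⟩; exact (bV i).2)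
  have h2 : Submodule.span ℂ (Set.range
      ((complexBetti.map χ.hom.hom.hom 1).hom ∘ fun i => (bV i : complexBetti A.X 1))) ≤
        Module.End.eigenspace (complexBetti.map φ.hom.hom.hom 1).hom (-(Complex.I * (Real.sqrt a : ℂ))) :=
    Submodule.span_le.2 (by
      rintro _ ⟨i, rfl⟩
      exact map_mem_eigenspace_neg_of_anticomm hφχ (bV i).2)
  exact (disjoint_iff.2 (eigenspace_inf_eigenspace_neg_eq_bot ha φ)).mono h1 h2

/-- **`dim S = 2n + 1`** for the span `S` of the mixed wedges `d_j` of an eigenframe.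
[cite: vanGeemenVerra2003QuaternionicPryms, proof of Prop. 4.7] -/
theorem finrank_span_mixedWedges (ha : 0 < a) (hφχ : φ ≫ χ = -(χ ≫ φ))
    (w : Fin (2 * n) → complexBetti A.X 1)
    (hw : ∀ i, w i ∈ Module.End.eigenspace (complexBetti.map φ.hom.hom.hom 1).hom
      (Complex.I * (Real.sqrt a : ℂ)))
    (hli : LinearIndependent ℂ (Sum.elim w (fun i => complexBetti.map χ.hom.hom.hom 1 (w i)))) :
    Module.finrank ℂ (Submodule.span ℂ (Set.range fun j : Fin (2 * n + 1) =>
      ∑ s ∈ Finset.powersetCard (j : ℕ) Finset.univ, cupPowOne ℂ (ComplexPoints A.X) (2 * n)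
        (s.piecewise w (fun i => complexBetti.map χ.hom.hom.hom 1 (w i))))) = 2 * n + 1 := by
  have hd_ne := fun j : Fin (2 * n + 1) => sum_cupPowOne_piecewise_ne_zero w hli (Nat.lt_succ_iff.mp j.2)
  rw [finrank_span_eq_card
    (linearIndependent_sum_cupPowOne_piecewise w hφχ hw (I_mul_sqrt_ne_zero ha) hd_ne), Fintype.card_fin]

/-- **`W_F ⊗ ℂ ⊆ S`** for both quadratic subfields `ℚ(φ)`, `ℚ(χ)`: the four Weil lines are spanned by
wedges `⋀ᵢ(α wᵢ + β χ^*wᵢ)` of the eigenframe (`E₊(φ) = ℂ⋀w`, `E₋(φ) = ℂ⋀χ^*w`,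
`E_±(χ) = ℂ⋀(w ± ν⁻¹χ^*w)`, `ν = i√b`), their translates by `ℤ⟨φ, χ⟩` are again such wedges, and
every such wedge expands into the `d_j`. [cite: vanGeemenVerra2003QuaternionicPryms, 4.6 and proof of Prop. 4.7] -/
theorem quaternionClasses_le_span_mixedWedges (ha : 0 < a) (hb : 0 < b) (hA : A.dim = 2 * n)
    (hφ : φ ≫ φ = -(a • 𝟙 A)) (hχ : χ ≫ χ = -(b • 𝟙 A)) (hφχ : φ ≫ χ = -(χ ≫ φ))
    (w : Fin (2 * n) → complexBetti A.X 1)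
    (hw : ∀ i, w i ∈ Module.End.eigenspace (complexBetti.map φ.hom.hom.hom 1).hom
      (Complex.I * (Real.sqrt a : ℂ)))
    (hli : LinearIndependent ℂ (Sum.elim w (fun i => complexBetti.map χ.hom.hom.hom 1 (w i)))) :
    quaternionClasses A φ χ φ n a ≤ Submodule.span ℂ (Set.range fun j : Fin (2 * n + 1) =>
      ∑ s ∈ Finset.powersetCard (j : ℕ) Finset.univ, cupPowOne ℂ (ComplexPoints A.X) (2 * n)
        (s.piecewise w (fun i => complexBetti.map χ.hom.hom.hom 1 (w i)))) ∧
    quaternionClasses A φ χ χ n b ≤ Submodule.span ℂ (Set.range fun j : Fin (2 * n + 1) =>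
      ∑ s ∈ Finset.powersetCard (j : ℕ) Finset.univ, cupPowOne ℂ (ComplexPoints A.X) (2 * n)
        (s.piecewise w (fun i => complexBetti.map χ.hom.hom.hom 1 (w i)))) := by
  classical
  set S := Submodule.span ℂ (Set.range fun j : Fin (2 * n + 1) =>
      ∑ s ∈ Finset.powersetCard (j : ℕ) Finset.univ, cupPowOne ℂ (ComplexPoints A.X) (2 * n)
        (s.piecewise w (fun i => complexBetti.map χ.hom.hom.hom 1 (w i)))) with hSdef
  have hν0 : Complex.I * (Real.sqrt b : ℂ) ≠ 0 := I_mul_sqrt_ne_zero hb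
  have hνsq : (Complex.I * (Real.sqrt b : ℂ)) ^ 2 = -(b : ℂ) := I_mul_sqrt_sq b
  have hΛ := Motives.AbelianVariety.hasExteriorCohomologyH1_complexPoints A
  have hb₁ : Module.finrank ℂ (complexBetti A.X 1) = 2 * (2 * n) := by
    rw [Motives.AbelianVariety.finrank_complexBetti_one, hA]
  have hΨw : ∀ i, complexBetti.map χ.hom.hom.hom 1 (w i) ∈
      Module.End.eigenspace (complexBetti.map φ.hom.hom.hom 1).hom (-(Complex.I * (Real.sqrt a : ℂ))) :=
    fun i => map_mem_eigenspace_neg_of_anticomm hφχ (hw i)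
  -- every wedge `⋀ᵢ(α wᵢ + β χ^*wᵢ)` lies in `S`
  have hΩS : ∀ α β : ℂ, cupPowOne ℂ (ComplexPoints A.X) (2 * n)
      (fun i => α • w i + β • complexBetti.map χ.hom.hom.hom 1 (w i)) ∈ S := by
    intro α β
    rw [multilinear_add_smul_expand_card _ α β w _]
    exact Submodule.sum_mem _ fun j _ => Submodule.smul_mem _ _ (Submodule.subset_span ⟨j, rfl⟩)
  -- translates of the wedges stay in `S`
  have hmapline : ∀ (q : Fin 4 → ℤ) (α₀ β₀ : ℂ),
      (ℂ ∙ cupPowOne ℂ (ComplexPoints A.X) (2 * n)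
          (fun i => α₀ • w i + β₀ • complexBetti.map χ.hom.hom.hom 1 (w i))).map
        (complexBetti.map (quaternionElement A φ χ q).hom.hom.hom (2 * n)).hom ≤ S := by
    intro q α₀ β₀
    rw [Submodule.map_span, Set.image_singleton, Submodule.span_singleton_le_iff_mem]
    change complexBetti.map (quaternionElement A φ χ q).hom.hom.hom (2 * n) _ ∈ S
    rw [map_quaternionElement_cupPowOne w hχ hφχ hw q α₀ β₀]
    exact hΩS _ _
  -- the wedges are non-zero
  have hne : ∀ α β : ℂ, (α ≠ 0 ∨ β ≠ 0) → cupPowOne ℂ (ComplexPoints A.X) (2 * n)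
      (fun i => α • w i + β • complexBetti.map χ.hom.hom.hom 1 (w i)) ≠ 0 :=
    fun α β h => cupPowOne_ne_zero_of_linearIndependent A (linearIndependent_smul_add_smul hli h)
  -- the four Weil lines
  have hEp : weilClassesPlus A φ n a ≤ ℂ ∙ cupPowOne ℂ (ComplexPoints A.X) (2 * n)
      (fun i => (1 : ℂ) • w i + (0 : ℂ) • complexBetti.map χ.hom.hom.hom 1 (w i)) :=
    weilClassesPlus_le_span_singleton hΛ hb₁ ha hφ
      (cupPowOne_mem_weilClassesPlus (fun i => by simpa using hw i)) (hne 1 0 (Or.inl one_ne_zero))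
  have hEm : weilClassesMinus A φ n a ≤ ℂ ∙ cupPowOne ℂ (ComplexPoints A.X) (2 * n)
      (fun i => (0 : ℂ) • w i + (1 : ℂ) • complexBetti.map χ.hom.hom.hom 1 (w i)) :=
    weilClassesMinus_le_span_singleton hΛ hb₁ ha hφ
      (cupPowOne_mem_weilClassesMinus (fun i => by simpa using hΨw i)) (hne 0 1 (Or.inr one_ne_zero))
  have hEp' : weilClassesPlus A χ n b ≤ ℂ ∙ cupPowOne ℂ (ComplexPoints A.X) (2 * n)
      (fun i => (1 : ℂ) • w i +
        (Complex.I * (Real.sqrt b : ℂ))⁻¹ • complexBetti.map χ.hom.hom.hom 1 (w i)) :=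
    weilClassesPlus_le_span_singleton hΛ hb₁ hb hχ
      (cupPowOne_mem_weilClassesPlus (fun i => by
        simpa only [one_smul] using add_smul_map_mem_eigenspace hχ hνsq hν0 (w i)))
      (hne 1 _ (Or.inl one_ne_zero))
  have hEm' : weilClassesMinus A χ n b ≤ ℂ ∙ cupPowOne ℂ (ComplexPoints A.X) (2 * n)
      (fun i => (1 : ℂ) • w i +
        (-(Complex.I * (Real.sqrt b : ℂ)))⁻¹ • complexBetti.map χ.hom.hom.hom 1 (w i)) :=
    weilClassesMinus_le_span_singleton hΛ hb₁ hb hχ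
      (cupPowOne_mem_weilClassesMinus (fun i => by
        simpa only [one_smul] using sub_smul_map_mem_eigenspace_neg hχ hνsq hν0 (w i)))
      (hne 1 _ (Or.inl one_ne_zero))
  constructor
  · unfold quaternionClasses
    refine iSup_le fun q => ?_
    rw [weilClassesOf, Submodule.map_sup]
    exact sup_le ((Submodule.map_mono hEp).trans (hmapline q 1 0))
      ((Submodule.map_mono hEm).trans (hmapline q 0 1))
  · unfold quaternionClasses
    refine iSup_le fun q => ?_
    rw [weilClassesOf, Submodule.map_sup]
    exact sup_le ((Submodule.map_mono hEp').trans (hmapline q 1 _))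
      ((Submodule.map_mono hEm').trans (hmapline q 1 _))

/-- **`S ⊆ W_F ⊗ ℂ`** (`K = ℚ(φ)`): the translates `(m + χ)^* ⋀ᵢ wᵢ = ⋀ᵢ (m wᵢ + χ^* wᵢ) = ∑ⱼ mʲ d_j`,
`m = 0, …, 2n`, lie in `W_F ⊗ ℂ`, and a Vandermonde inversion extracts each `d_j`.
[cite: vanGeemenVerra2003QuaternionicPryms, 4.6 and proof of Prop. 4.7] -/
theorem span_mixedWedges_le_quaternionClasses (hb : 0 < b)
    (hχ : χ ≫ χ = -(b • 𝟙 A)) (hφχ : φ ≫ χ = -(χ ≫ φ))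
    (w : Fin (2 * n) → complexBetti A.X 1)
    (hw : ∀ i, w i ∈ Module.End.eigenspace (complexBetti.map φ.hom.hom.hom 1).hom
      (Complex.I * (Real.sqrt a : ℂ))) :
    Submodule.span ℂ (Set.range fun j : Fin (2 * n + 1) =>
      ∑ s ∈ Finset.powersetCard (j : ℕ) Finset.univ, cupPowOne ℂ (ComplexPoints A.X) (2 * n)
        (s.piecewise w (fun i => complexBetti.map χ.hom.hom.hom 1 (w i)))) ≤
      quaternionClasses A φ χ φ n a := by
  classical
  have _hb := hb
  refine Submodule.span_le.2 ?_
  rintro _ ⟨j, rfl⟩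
  rw [SetLike.mem_coe]
  refine mem_of_vandermonde (quaternionClasses A φ χ φ n a) (fun m : Fin (2 * n + 1) => ((m : ℕ) : ℂ))
    (fun m m' h => Fin.ext (Nat.cast_injective h))
    (fun j : Fin (2 * n + 1) => ∑ s ∈ Finset.powersetCard (j : ℕ) Finset.univ,
      cupPowOne ℂ (ComplexPoints A.X) (2 * n)
        (s.piecewise w (fun i => complexBetti.map χ.hom.hom.hom 1 (w i)))) (fun m => ?_) j
  have h1 := map_quaternionElement_cupPowOne w hχ hφχ hw ![((m : ℕ) : ℤ), 0, 1, 0] 1 0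
  have h2 : cupPowOne ℂ (ComplexPoints A.X) (2 * n)
      (fun i => ((m : ℕ) : ℂ) • w i + (1 : ℂ) • complexBetti.map χ.hom.hom.hom 1 (w i)) =
      complexBetti.map (quaternionElement A φ χ ![((m : ℕ) : ℤ), 0, 1, 0]).hom.hom.hom (2 * n)
        (cupPowOne ℂ (ComplexPoints A.X) (2 * n)
          (fun i => (1 : ℂ) • w i + (0 : ℂ) • complexBetti.map χ.hom.hom.hom 1 (w i))) := by
    rw [h1]
    congr 1
    funext i
    simp
  have h3 : ∑ j : Fin (2 * n + 1), ((m : ℕ) : ℂ) ^ (j : ℕ) •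
      ∑ s ∈ Finset.powersetCard (j : ℕ) Finset.univ, cupPowOne ℂ (ComplexPoints A.X) (2 * n)
        (s.piecewise w (fun i => complexBetti.map χ.hom.hom.hom 1 (w i))) =
      cupPowOne ℂ (ComplexPoints A.X) (2 * n)
        (fun i => ((m : ℕ) : ℂ) • w i + (1 : ℂ) • complexBetti.map χ.hom.hom.hom 1 (w i)) := by
    rw [multilinear_add_smul_expand_card _ _ _ w _]
    simp only [one_pow, mul_one]
  rw [h3, h2]
  refine map_weilClassesOf_le_quaternionClasses φ n a _ (Submodule.mem_map_of_mem ?_)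
  exact weilClassesPlus_le_weilClassesOf A φ n a
    (cupPowOne_mem_weilClassesPlus (fun i => by simpa using hw i))

/-- The structure statement behind Prop. 4.7: `W_F ⊗ ℂ` (built on `K = ℚ(φ)`) is a `(2n+1)`-dimensional
subspace containing the one built on `K = ℚ(χ)`. [cite: vanGeemenVerra2003QuaternionicPryms, proof of Prop. 4.7] -/
private theorem exists_span_mixedWedges (ha : 0 < a) (hb : 0 < b) (hA : A.dim = 2 * n)
    (hφ : φ ≫ φ = -(a • 𝟙 A)) (hχ : χ ≫ χ = -(b • 𝟙 A)) (hφχ : φ ≫ χ = -(χ ≫ φ)) :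
    ∃ S : Submodule ℂ (complexBetti A.X (2 * n)),
      Module.finrank ℂ S = 2 * n + 1 ∧ quaternionClasses A φ χ φ n a = S ∧
        quaternionClasses A φ χ χ n b ≤ S := by
  obtain ⟨w, hw, hli⟩ := exists_eigenframe ha hb hA hφ hχ hφχ
  obtain ⟨hφS, hχS⟩ := quaternionClasses_le_span_mixedWedges ha hb hA hφ hχ hφχ w hw hli
  exact ⟨_, finrank_span_mixedWedges ha hφχ w hw hli,
    le_antisymm hφS (span_mixedWedges_le_quaternionClasses hb hχ hφχ w hw), hχS⟩

/-- **Van Geemen–Verra 2003, Prop. 4.7 (dimension): `dim_ℂ (W_F ⊗ ℂ) = 2n + 1`** for a complex abelian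
`2n`-fold with `φ² = -a`, `χ² = -b` (`a, b ≥ 1`), `φχ = -χφ` — no polarization hypothesis is needed.
[cite: vanGeemenVerra2003QuaternionicPryms, Prop. 4.7] -/
theorem finrank_quaternionClasses (ha : 0 < a) (hb : 0 < b) (hA : A.dim = 2 * n)
    (hφ : φ ≫ φ = -(a • 𝟙 A)) (hχ : χ ≫ χ = -(b • 𝟙 A)) (hφχ : φ ≫ χ = -(χ ≫ φ)) :
    Module.finrank ℂ (quaternionClasses A φ χ φ n a) = 2 * n + 1 := by
  obtain ⟨S, hS, hQ, -⟩ := exists_span_mixedWedges ha hb hA hφ hχ hφχ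
  rw [hQ]
  exact hS

/-- **Van Geemen–Verra 2003, Prop. 4.7 (independence of the quadratic subfield): the subspace `W_F ⊗ ℂ`
built from `K = ℚ(φ)` equals the one built from `K = ℚ(χ)`** — no polarization hypothesis is needed.
[cite: vanGeemenVerra2003QuaternionicPryms, Prop. 4.7] -/
theorem quaternionClasses_eq_quaternionClasses (ha : 0 < a) (hb : 0 < b) (hA : A.dim = 2 * n)
    (hφ : φ ≫ φ = -(a • 𝟙 A)) (hχ : χ ≫ χ = -(b • 𝟙 A)) (hφχ : φ ≫ χ = -(χ ≫ φ)) :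
    quaternionClasses A φ χ φ n a = quaternionClasses A φ χ χ n b := by
  obtain ⟨S, -, hQ, hle⟩ := exists_span_mixedWedges ha hb hA hφ hχ hφχ
  obtain ⟨S', -, hQ', hle'⟩ := exists_span_mixedWedges hb ha hA hχ hφ (comp_eq_neg_comp_of_anticomm hφχ)
  refine le_antisymm ?_ ?_
  · rw [quaternionClasses_swap hφχ φ a, quaternionClasses_swap hφχ χ b, hQ']
    exact hle'
  · rw [hQ]
    exact hle

/-- **Van Geemen–Verra 2003, Prop. 4.7 (Hodge classes): `W_F ⊗ ℂ ⊆ Bⁿ ⊗ ℂ`** (`n ≥ 1`): `(A, ℚ(φ))` is of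
Weil type (Lemma 4.5, the tree's `isWeilType_of_anticomm`), so the Weil plane is spanned by rational
`(n,n)`-classes, and pull-backs along endomorphisms preserve rational `(n,n)`-classes.
[cite: vanGeemenVerra2003QuaternionicPryms, Lemma 4.5 and Prop. 4.7] -/
theorem quaternionClasses_le_hodgeClassSpan (hn : 0 < n) (ha : 0 < a) (hb : 0 < b) (hA : A.dim = 2 * n)
    (hφ : φ ≫ φ = -(a • 𝟙 A)) (hχ : χ ≫ χ = -(b • 𝟙 A)) (hφχ : φ ≫ χ = -(χ ≫ φ)) :
    quaternionClasses A φ χ φ n a ≤ hodgeClassSpan A.dim A.X n := by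
  have hWT : IsWeilType A φ n a := isWeilType_of_anticomm hn ha hb hA hφ hχ hφχ
  have hW : weilClassesOf A φ n a ≤ hodgeClassSpan A.dim A.X n := by
    rw [weilClassesOf_eq_span_isRationalClass hn hA ha hφ]
    refine Submodule.span_le.2 ?_
    rintro c ⟨hc, hcW⟩
    refine Submodule.subset_span ⟨hc, ?_⟩
    rw [hA]
    exact hWT.isOfHodgeType_of_mem_weilClassesOf hcW
  unfold quaternionClasses
  refine iSup_le fun q => (Submodule.map_mono hW).trans ?_
  exact hodgeClassSpan_map_le (AbelianVariety.isSmoothProjective_holds (A := A))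
    (AbelianVariety.isSmoothProjective_holds (A := A)) _ n

/-- **Van Geemen–Verra 2003, Proposition 4.7, the three conjuncts of the tree's named fact
`VanGeemenVerra2003_quaternionHodgeClasses`** (independence of `K`, `W_F ⊗ ℂ ⊆ Bⁿ ⊗ ℂ`,
`dim = 2n + 1`), PROVED for every complex abelian `2n`-fold (`n ≥ 1`) with quaternion multiplication
`φ² = -a`, `χ² = -b`, `φχ = -χφ` — without the polarization hypotheses of the fact.
[cite: vanGeemenVerra2003QuaternionicPryms, Prop. 4.7] -/
theorem prop47 (hn : 0 < n) (ha : 0 < a) (hb : 0 < b) (hA : A.dim = 2 * n)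
    (hφ : φ ≫ φ = -(a • 𝟙 A)) (hχ : χ ≫ χ = -(b • 𝟙 A)) (hφχ : φ ≫ χ = -(χ ≫ φ)) :
    quaternionClasses A φ χ φ n a = quaternionClasses A φ χ χ n b ∧
      quaternionClasses A φ χ φ n a ≤ hodgeClassSpan A.dim A.X n ∧
      Module.finrank ℂ (quaternionClasses A φ χ φ n a) = 2 * n + 1 :=
  ⟨quaternionClasses_eq_quaternionClasses ha hb hA hφ hχ hφχ,
    quaternionClasses_le_hodgeClassSpan hn ha hb hA hφ hχ hφχ,
    finrank_quaternionClasses ha hb hA hφ hχ hφχ⟩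

end Prop47


/-! ### E. The named fact reduces to its general-member clause (§4.8) -/

section Residual

/-- **The residual of the named fact `VanGeemenVerra2003_quaternionHodgeClasses` is exactly its §4.8
(general-member) clause.** With Lemma 4.5 (`HodgeTheory.weilClasses_isOfHodgeType_of_anticomm`, for
`(A, ℚ(φ))` and `(A, ℚ(χ))`) and Prop. 4.7 (`prop47`) proved, the fact — Lemma 4.5 + Prop. 4.7 + §4.8
under the polarization hypotheses of a polarized abelian variety of quaternion type — is EQUIVALENT to
its last conjunct alone: "for a GENERAL such `A` (`IsGeneralQuaternionType`), `Bᵖ ⊗ ℂ = Dᵖ ⊗ ℂ` for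
`p ≠ n` and `Bⁿ ⊗ ℂ = (Dⁿ ⊗ ℂ) ⊕ (W_F ⊗ ℂ)`" ([A] Thm. 4.1, the `SO(2n)`-invariant theory, NOT proved
in the tree). [cite: vanGeemenVerra2003QuaternionicPryms, Lemma 4.5, Prop. 4.7 and 4.8]
[cite: Abdulali1999TypeIII, Thm. 4.1] -/
theorem vanGeemenVerra2003_quaternionHodgeClasses_iff_general :
    VanGeemenVerra2003_quaternionHodgeClasses ↔
      ∀ (A : AbelianVariety ℂ) (φ χ : A ⟶ A) (n a b : ℕ) (e : ProjectiveEmbedding A.X)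
        (l : complexBetti (projectiveSpace e.n ℂ) 2),
        2 ≤ n → 0 < a → 0 < b → A.dim = 2 * n →
        φ ≫ φ = -(a • 𝟙 A) → χ ≫ χ = -(b • 𝟙 A) → φ ≫ χ = -(χ ≫ φ) →
        IsRationalClass l → l ≠ 0 →
        complexBetti.map φ.hom.hom.hom 2 (complexBetti.map e.ι 2 l) = (a : ℂ) • complexBetti.map e.ι 2 l →
        complexBetti.map χ.hom.hom.hom 2 (complexBetti.map e.ι 2 l) = (b : ℂ) • complexBetti.map e.ι 2 l →
        IsGeneralQuaternionType A φ χ n (complexBetti.map e.ι 2 l) →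
          (∀ p : ℕ, p ≠ n → hodgeClassSpan A.dim A.X p = divisorClassesSpan A.X A.dim p) ∧
            hodgeClassSpan A.dim A.X n = divisorClassesSpan A.X A.dim n ⊔ quaternionClasses A φ χ φ n a ∧
            Disjoint (divisorClassesSpan A.X A.dim n) (quaternionClasses A φ χ φ n a) := by
  constructor
  · intro h A φ χ n a b e l hn ha hb hA hφ hχ hφχ hl hl0 hEφ hEχ hgen
    exact (h A φ χ n a b e l hn ha hb hA hφ hχ hφχ hl hl0 hEφ hEχ).2.2.2.2.2 hgen
  · intro h A φ χ n a b e l hn ha hb hA hφ hχ hφχ hl hl0 hEφ hEχ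
    have hn' : 0 < n := by omega
    obtain ⟨h₁, h₂, h₃⟩ := prop47 hn' ha hb hA hφ hχ hφχ
    exact ⟨weilClasses_isOfHodgeType_of_anticomm hn' ha hb hA hφ hχ hφχ,
      weilClasses_isOfHodgeType_of_anticomm hn' hb ha hA hχ hφ (comp_eq_neg_comp_of_anticomm hφχ),
      h₁, h₂, h₃, h A φ χ n a b e l hn ha hb hA hφ hχ hφχ hl hl0 hEφ hEχ⟩

end Residual

end Literature.AlgebraicGeometry.VanGeemenVerra2003

end
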